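import Mathlib
import Summits.MatrixMultiplication.MatrixMultiplication.Theses.GLnSeparatingDesigns
import Literature.NumberTheory.Automorphic.GaussCellGL

/-!
# Strategist sketch — crux `BorderHalfDimensionDesigns` (stmt-MatrixMultiplication-18360)

Two typed findings of the strategy census (STRATEGY-CENSUS.md):

* § Strengthen/Transfer: `UnitaryRealDesigns` (designs inside `U_n` with SESQUI-polynomial separators,
  i.e. polynomials in the entries AND their conjugates) implies the crux, because on `U_n`
  `conj(u_ij) = adj(u)_ji / det u` is holomorphic-rational: `sesquiToHolomorphic` (degree `s ↦ (n+1)s`,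
  value multiplied by the unit `det^s`).  Signatures only; the algebraic core `det_smul_star_eq_adjugate`
  is proved.
* § Negation: `LatticeSparseFlagMinorDesigns` = the transferred C⁺ of card `bruhat-zero-set-splitting`
  (middle set read through torus-invariant Laurent monomials in the flag minors, denominators cleared);
  conjectured FALSE for every `ε < 1/6` by the lead's LU/highest-weight span count (the same engine that
  refutes `FlagMinorHypersurfaceDesigns`), see `latticeSparse_count` (signature of the counting core).
-/

set_option linter.dupNamespace false

open scoped BigOperators Matrix
open Summit.MatrixMultiplication.MatrixMultiplication.Theses.GLnSeparatingDesigns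

namespace Summit.MatrixMultiplication.MatrixMultiplication.Cruxes.BorderHalfDimensionDesigns.Strategist

abbrev GLn (n : ℕ) := Matrix.GeneralLinearGroup (Fin n) ℂ

/-! ## 1. The unitary / real-separator form of the crux -/

/-- On the unitary group, `det u • star u = adjugate u` (so `conj (u i j) = (adjugate u) j i / det u`
is a holomorphic rational function of the entries). [folklore] -/
theorem det_smul_star_eq_adjugate {n : ℕ} (A : Matrix (Fin n) (Fin n) ℂ)
    (hA : A ∈ Matrix.unitaryGroup (Fin n) ℂ) : A.det • star A = A.adjugate := by
  have h : A * star A = 1 := Matrix.mem_unitaryGroup_iff.mp hA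
  calc A.det • star A = (A.det • (1 : Matrix (Fin n) (Fin n) ℂ)) * star A := by
          rw [Matrix.smul_mul, Matrix.one_mul]
    _ = (A.adjugate * A) * star A := by rw [Matrix.adjugate_mul]
    _ = A.adjugate := by rw [Matrix.mul_assoc, h, Matrix.mul_one]

/-- Entrywise form: `conj (A i j) · det A = adjugate A j i` for unitary `A`. [folklore] -/
theorem det_mul_star_apply {n : ℕ} (A : Matrix (Fin n) (Fin n) ℂ)
    (hA : A ∈ Matrix.unitaryGroup (Fin n) ℂ) (i j : Fin n) :
    A.det * star (A i j) = A.adjugate j i := by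
  have h := congrFun (congrFun (det_smul_star_eq_adjugate A hA) j) i
  simpa [Matrix.smul_apply, Matrix.star_apply, smul_eq_mul] using h

/-- SIGNATURE (det-trick, to be proved by a prover): a sesqui-polynomial of total degree `≤ s` in the
entries and conjugate entries agrees on `U_n`, up to the unit factor `det^s`, with a HOLOMORPHIC
polynomial of total degree `≤ (n+1)s` (substitute `conj x_ij ↦ adj_ji`, pad with `det^{s-b}`). -/
def SesquiToHolomorphic : Prop :=
  ∀ n s : ℕ, ∀ P : MvPolynomial ((Fin n × Fin n) ⊕ (Fin n × Fin n)) ℂ, P.totalDegree ≤ s →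
    ∃ F : MvPolynomial (Fin n × Fin n) ℂ, F.totalDegree ≤ (n + 1) * s ∧
      ∀ A : Matrix (Fin n) (Fin n) ℂ, A ∈ Matrix.unitaryGroup (Fin n) ℂ →
        MvPolynomial.eval (fun ij : Fin n × Fin n => A ij.1 ij.2) F =
          A.det ^ s * MvPolynomial.eval
            (Sum.elim (fun ij : Fin n × Fin n => A ij.1 ij.2) (fun ij => star (A ij.1 ij.2))) P

/-- `C_U` — the crux restricted to UNITARY designs but with SESQUI-polynomial (real-algebraic)
separators: for every `ε > 0` some `n ≥ 3` carries, for every `δ > 0`, arbitrarily large `q` and every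
`η > 0`, TPP subsets `X, Y, Z ⊆ U_n ⊆ GL_n(ℂ)` of sizes `≥ q^(n²/2 − εn)` whose target indicators on
`X Y⁻¹ Y Z⁻¹` are `η`-approximated by polynomials of total degree `≤ q^(1+δ)` in the `2n²` functions
`M_ij, conj M_ij`.  BCGPU 2024 §4 bullet 2 asks for the `U_n` construction as "an important step";
with `SesquiToHolomorphic` it is SUFFICIENT (`borderHalfDimensionDesigns_of_unitaryReal`). -/
def UnitaryRealDesigns : Prop :=
  ∀ ε : ℝ, 0 < ε → ∃ n : ℕ, 3 ≤ n ∧ ∀ δ : ℝ, 0 < δ → ∀ q₀ : ℕ, ∃ q : ℕ, q₀ ≤ q ∧ ∀ η : ℝ, 0 < η →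
    ∃ X Y Z : Finset (GLn n),
      (∀ x ∈ X ∪ Y ∪ Z, (x : Matrix (Fin n) (Fin n) ℂ) ∈ Matrix.unitaryGroup (Fin n) ℂ) ∧
      (∀ x ∈ X, ∀ x' ∈ X, ∀ y ∈ Y, ∀ y' ∈ Y, ∀ z ∈ Z, ∀ z' ∈ Z,
        x * y⁻¹ * y' * z⁻¹ = x' * z'⁻¹ → x = x' ∧ y = y' ∧ z = z') ∧
      (q : ℝ) ^ ((n : ℝ) ^ 2 / 2 - ε * n) ≤ (X.card : ℝ) ∧
      (q : ℝ) ^ ((n : ℝ) ^ 2 / 2 - ε * n) ≤ (Y.card : ℝ) ∧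
      (q : ℝ) ^ ((n : ℝ) ^ 2 / 2 - ε * n) ≤ (Z.card : ℝ) ∧
      ∀ x₀ ∈ X, ∀ z₀ ∈ Z, ∃ p : MvPolynomial ((Fin n × Fin n) ⊕ (Fin n × Fin n)) ℂ,
        (p.totalDegree : ℝ) ≤ (q : ℝ) ^ (1 + δ) ∧
        ∀ x ∈ X, ∀ y ∈ Y, ∀ y' ∈ Y, ∀ z ∈ Z,
          ((x = x₀ ∧ y = y' ∧ z = z₀) →
            ‖MvPolynomial.eval (Sum.elim
                (fun ij : Fin n × Fin n => ((x * y⁻¹ * y' * z⁻¹ : GLn n) : Matrix (Fin n) (Fin n) ℂ) ij.1 ij.2)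
                (fun ij => star (((x * y⁻¹ * y' * z⁻¹ : GLn n) : Matrix (Fin n) (Fin n) ℂ) ij.1 ij.2))) p
              - 1‖ ≤ η) ∧
          (¬ (x = x₀ ∧ y = y' ∧ z = z₀) →
            ‖MvPolynomial.eval (Sum.elim
                (fun ij : Fin n × Fin n => ((x * y⁻¹ * y' * z⁻¹ : GLn n) : Matrix (Fin n) (Fin n) ℂ) ij.1 ij.2)
                (fun ij => star (((x * y⁻¹ * y' * z⁻¹ : GLn n) : Matrix (Fin n) (Fin n) ℂ) ij.1 ij.2))) p‖
              ≤ η)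

/-- SIGNATURE (transfer, prover work; uses `SesquiToHolomorphic`, `|det| = 1` on `U_n`, and
`(n+1) q^(1+δ/2) ≤ q^(1+δ)` for large `q`): unitary real-separator designs are border half-dimensional
designs. -/
def UnitaryTransfer : Prop := SesquiToHolomorphic → UnitaryRealDesigns → BorderHalfDimensionDesigns

/-! ## 2. Negation side: the lattice-sparse flag-minor middle set (card `bruhat-zero-set-splitting`) -/

/-- The transferred C⁺ of card `bruhat-zero-set-splitting`, denominators cleared: a middle set `Y`
of size `≥ q^(n²/2−εn)` and ONE polynomial `R` in the `n` leading principal minors, of total degree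
`≤ q^(1+δ)`, non-vanishing at `Δ(1) = (1,…,1)`, vanishing at `Δ(y⁻¹y')` for `y ≠ y'`, whose exponent
vectors lie in ONE coset of a lattice of rank `c ≤ 2εn` (= invariance under the outer tori `T₁ × T₂`,
`dim T₁ + dim T₂ = n − c`, which the outer sizes `q^((n²−n)/2 + dim Tᵢ) ≥ q^(n²/2−εn)` force). -/
def LatticeSparseFlagMinorDesigns : Prop :=
  ∀ ε : ℝ, 0 < ε → ∃ n : ℕ, 3 ≤ n ∧ ∀ δ : ℝ, 0 < δ → ∀ q₀ : ℕ, ∃ q : ℕ, q₀ ≤ q ∧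
    ∃ (c : ℕ) (E : Fin c → (Fin n → ℤ)) (μ₀ : Fin n → ℤ), (c : ℝ) ≤ 2 * ε * n ∧
    ∃ Y : Finset (GLn n), ∃ R : MvPolynomial (Fin n) ℂ,
      (q : ℝ) ^ ((n : ℝ) ^ 2 / 2 - ε * n) ≤ (Y.card : ℝ) ∧
      (R.totalDegree : ℝ) ≤ (q : ℝ) ^ (1 + δ) ∧
      (∀ m ∈ R.support, ∃ k : Fin c → ℤ, (fun j : Fin n => (m j : ℤ)) = μ₀ + ∑ i, k i • E i) ∧
      MvPolynomial.eval (fun _ => (1 : ℂ)) R ≠ 0 ∧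
      ∀ y ∈ Y, ∀ y' ∈ Y, y ≠ y' →
        MvPolynomial.eval (fun j : Fin n =>
          Literature.NumberTheory.Automorphic.leadMinor Fin.castSucc
            ((y⁻¹ * y' : GLn n) : Matrix (Fin n) (Fin n) ℂ) j.succ) R = 0

/-- SIGNATURE of the counting core (the lead's LU/highest-weight engine + a lattice-box count):
a flag-minor test `R` with `≤ K` monomials, each of weight `≤ d`, caps the middle set at
`K · (n d + 1)^(n(n−1)/2)`; for the lattice-sparse family `K ≤ (d+1)^c`. -/
def LatticeSparseCount : Prop :=
  ∀ n : ℕ, 3 ≤ n → ∀ (c d : ℕ) (E : Fin c → (Fin n → ℤ)) (μ₀ : Fin n → ℤ)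
    (Y : Finset (GLn n)) (R : MvPolynomial (Fin n) ℂ),
    R.totalDegree ≤ d →
    (∀ m ∈ R.support, ∃ k : Fin c → ℤ, (fun j : Fin n => (m j : ℤ)) = μ₀ + ∑ i, k i • E i) →
    MvPolynomial.eval (fun _ => (1 : ℂ)) R ≠ 0 →
    (∀ y ∈ Y, ∀ y' ∈ Y, y ≠ y' →
      MvPolynomial.eval (fun j : Fin n =>
        Literature.NumberTheory.Automorphic.leadMinor Fin.castSucc
          ((y⁻¹ * y' : GLn n) : Matrix (Fin n) (Fin n) ℂ) j.succ) R = 0) →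
    Y.card ≤ (d + 1) ^ c * (n * d + 1) ^ (n * (n - 1) / 2)

/-- The numerics that turn the count into `¬ LatticeSparseFlagMinorDesigns` for `ε < 1/6`:
with `d ≤ q^(1+δ)`, `c ≤ 2εn`: exponent `(1+δ)(2εn + n(n−1)/2) + o(1) < n²/2 − εn` iff
`3εn + δ·(n²/2 − n/2 + 2εn) < n/2`, which holds for `δ < (1 − 6ε)/(2n)`. -/
example : (3 : ℝ) * (1 / 6) = 1 / 2 := by norm_num

end Summit.MatrixMultiplication.MatrixMultiplication.Cruxes.BorderHalfDimensionDesigns.Strategist
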